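import Summits.HubbardSuperconductivity.HubbardSuperconductivity.Theorems.AnisotropyChordVirialMonotone
import Summits.HubbardSuperconductivity.HubbardSuperconductivity.Theorems.AnisotropyChordConcavityOneMagnonCoordinates
import Literature.MathematicalPhysics.QuantumLattice.XYZGroundStateOrderHolds
import Literature.MathematicalPhysics.QuantumLattice.HeisenbergTorusSubadditivity
import Literature.MathematicalPhysics.QuantumLattice.SpinHalfCasimirBound
import Literature.Combinatorics.SimpleGraph.LovaszThetaComplement

/-!
# Route `AnisotropyChord`: THEOREM VI of the theory seat on the complete graph `K_n` — `⟨𝐒²_tot⟩` and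
# the condensate of the sector ground states are non-decreasing in the anisotropy, every sector,
# all `Δ₁ < Δ₂ ≤ 1` (a positive vertex-transitive instance of `U_vt` in ALL sectors)

On `K_n` (spin ½) the Casimir is an affine function of the isotropic ferromagnet:
`𝐒²_tot = Σ_x 𝐒_x² + Σ_{x≠y} 𝐒_x·𝐒_y = (3n/4)·1 + 2 Σ_{E(K_n)} 𝐒_x·𝐒_y = (3n/4)·1 − 2 H(1)`,
`H(Δ) = xxzHamiltonian 1 ⊤ (−1) Δ` (`totalSpinSq_eq_casimir_add_two_smul_sum_edges`,
`completeGraph_re_totalSpinSq`).  Theorem V at the pencil point `Δ⋆ = 1`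
(`casimir_monotone_of_block`, file `…VirialMonotone`) then gives, for normalised sector ground states
`ψ₁` at `Δ₁` and `ψ₂` at `Δ₂` with `Δ₁ < Δ₂ ≤ 1` (any sector, no lower bound on `Δ₁`):
`⟨𝐒²⟩_{ψ₁} ≤ ⟨𝐒²⟩_{ψ₂}` (`completeGraph_totalSpinSq_monotone`) and, by
`Re⟨ψ,𝐒²ψ⟩ = Λ(ψ) + (M²−M)‖ψ‖²`, `Λ(ψ₁) ≤ Λ(ψ₂)` (`completeGraph_condensate_monotone`): the conjecture
`U_vt` (`…SpinMonotoneDefs.VertexTransitiveCondensateMonotone`; `K_n` is vertex-transitive,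
`Literature…isVertexTransitive_top`) holds on `K_n` for `Δ₁ < Δ₂` — the block step of the theory
seat's Theorem VI is empty here because the identity is an operator identity.  (The equal-anisotropy
case `Δ₁ = Δ₂` would need uniqueness of the sector ground state and is not claimed.)  General spin
`n/2` version of the operator identity: `totalSpinSq_eq_sum_sum`.  No definition is introduced.
-/

set_option linter.dupNamespace false

noncomputable section

namespace Summit.HubbardSuperconductivity.HubbardSuperconductivity.Theorems.AnisotropyChord

open Matrix Complex Finset
open Literature.MathematicalPhysics.QuantumLattice

variable {V : Type*} [Fintype V] [DecidableEq V]

/-- `𝐒²_tot = Σ_x Σ_y Σ_α S^α_x S^α_y`, with the diagonal terms `Σ_α (S^α_x)² = S(S+1)·1` and the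
off-diagonal terms `𝐒_x·𝐒_y` (any spin `n/2`). [folklore] -/
theorem totalSpinSq_eq_sum_sum (n : ℕ) :
    (totalSpinSq n : Op V (n + 1)) =
      ∑ x, ∑ y, (if x = y then ((casimirValue n : ℝ) : ℂ) • (1 : Op V (n + 1)) else spinDot n x y) := by
  unfold totalSpinSq totalSpin
  simp_rw [Finset.sum_mul_sum]
  rw [Finset.sum_comm]
  refine Finset.sum_congr rfl fun x _ => ?_
  rw [Finset.sum_comm]
  refine Finset.sum_congr rfl fun y _ => ?_
  by_cases hxy : x = y
  · subst hxy
    rw [if_pos rfl, sum_siteSpin_mul_siteSpin_casimirValue]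
  · rw [if_neg hxy, spinDot_eq_sum_mul_of_ne n hxy]

/-- **The Casimir on the complete graph**: `𝐒²_tot = (|V|·S(S+1))·1 + 2 Σ_{e ∈ E(K_V)} 𝐒_x·𝐒_y`.
[folklore] -/
theorem totalSpinSq_eq_casimir_add_two_smul_sum_edges (n : ℕ) :
    (totalSpinSq n : Op V (n + 1)) =
      (((Fintype.card V : ℝ) * casimirValue n : ℝ) : ℂ) • (1 : Op V (n + 1))
        + (2 : ℂ) • ∑ e ∈ (⊤ : SimpleGraph V).edgeFinset, spinDotSym n e := by
  rw [totalSpinSq_eq_sum_sum]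
  have hsplit : ∀ x y : V,
      (if x = y then ((casimirValue n : ℝ) : ℂ) • (1 : Op V (n + 1)) else spinDot n x y)
        = (if x = y then ((casimirValue n : ℝ) : ℂ) • (1 : Op V (n + 1)) else 0)
          + (if (⊤ : SimpleGraph V).Adj x y then spinDot n x y else 0) := by
    intro x y
    by_cases h : x = y
    · simp [h]
    · rw [if_neg h, if_neg h, zero_add, if_pos ((SimpleGraph.top_adj x y).mpr h)]
  simp_rw [hsplit, Finset.sum_add_distrib]
  congr 1
  · simp_rw [Finset.sum_ite_eq, if_pos (Finset.mem_univ _)]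
    rw [Finset.sum_const, Finset.card_univ, ← Nat.cast_smul_eq_nsmul ℂ, smul_smul]
    push_cast
    ring_nf
  · rw [sum_sum_ite_adj_eq_sum_edgeFinset, Finset.smul_sum]
    refine Finset.sum_congr rfl fun e _ => ?_
    induction e using Sym2.ind with
    | h x y =>
      show spinDot n x y + spinDot n y x = (2 : ℂ) • spinDotSym n s(x, y)
      rw [spinDotSym_mk, two_smul, spinDot_comm n x y]

/-- **`H(1)` is the isotropic ferromagnet** (spin ½, `J = −1`):
`xxzHamiltonian 1 G (−1) 1 = −heisenbergHamiltonian 1 G 1` on every graph. [folklore] -/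
theorem xxz_at_one_eq_neg_heisenberg (G : SimpleGraph V) [DecidableRel G.Adj] :
    (xxzHamiltonian 1 G (-1) 1 : Op V 2) = -heisenbergHamiltonian 1 G 1 := by
  rw [OneMagnon.xxz_eq_neg_heisenberg_add_diagonal]
  simp

/-- **Casimir identity on `K_n`, spin ½**: `Re⟨ψ, 𝐒²ψ⟩ = (3/4)|V|·‖ψ‖² − 2 Re⟨ψ, H(1)ψ⟩`,
`H(1) = xxzHamiltonian 1 ⊤ (−1) 1`. [folklore] -/
theorem completeGraph_re_totalSpinSq (ψ : (V → Fin 2) → ℂ) :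
    (star ψ ⬝ᵥ ((totalSpinSq 1 : Op V 2) *ᵥ ψ)).re =
      (3 / 4 : ℝ) * (Fintype.card V : ℝ) * (star ψ ⬝ᵥ ψ).re
        - 2 * (star ψ ⬝ᵥ ((xxzHamiltonian 1 (⊤ : SimpleGraph V) (-1) 1 : Op V 2) *ᵥ ψ)).re := by
  rw [totalSpinSq_eq_casimir_add_two_smul_sum_edges, xxz_at_one_eq_neg_heisenberg, heisenbergHamiltonian]
  simp only [add_mulVec, smul_mulVec, neg_mulVec, one_mulVec, dotProduct_add, dotProduct_smul,
    dotProduct_neg, Complex.add_re, Complex.neg_re, smul_eq_mul, casimirValue,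
    Complex.ofReal_one, one_smul]
  have e1 : ∀ (r : ℝ) (z : ℂ), ((r : ℂ) * z).re = r * z.re := fun r z => Complex.re_ofReal_mul r z
  have e2 : ∀ z : ℂ, ((2 : ℂ) * z).re = 2 * z.re := fun z => by simp [Complex.mul_re]
  rw [e1, e2]
  push_cast
  ring

/-- **THEOREM VI on `K_n`** (theory seat `hubbard-h0-rotor-theory-1`, cycle 4): for normalised sector
ground states `ψ₁` of `H(Δ₁)` and `ψ₂` of `H(Δ₂)` on the complete graph, same sector, `Δ₁ < Δ₂ ≤ 1`:
`⟨𝐒²_tot⟩_{ψ₁} ≤ ⟨𝐒²_tot⟩_{ψ₂}`. [folklore] -/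
theorem completeGraph_totalSpinSq_monotone {M Δ₁ Δ₂ : ℝ} (h12 : Δ₁ < Δ₂) (h2 : Δ₂ ≤ 1)
    {ψ₁ ψ₂ : (V → Fin 2) → ℂ}
    (g₁m : ψ₁ ∈ spinZSector (Λ := V) 1 M) (g₁n : star ψ₁ ⬝ᵥ ψ₁ = 1)
    (g₁e : (xxzHamiltonian 1 (⊤ : SimpleGraph V) (-1) Δ₁ : Op V 2) *ᵥ ψ₁ =
      ((lowestEnergyInSector 1 (xxzHamiltonian 1 (⊤ : SimpleGraph V) (-1) Δ₁) M : ℝ) : ℂ) • ψ₁)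
    (g₂m : ψ₂ ∈ spinZSector (Λ := V) 1 M) (g₂n : star ψ₂ ⬝ᵥ ψ₂ = 1)
    (g₂e : (xxzHamiltonian 1 (⊤ : SimpleGraph V) (-1) Δ₂ : Op V 2) *ᵥ ψ₂ =
      ((lowestEnergyInSector 1 (xxzHamiltonian 1 (⊤ : SimpleGraph V) (-1) Δ₂) M : ℝ) : ℂ) • ψ₂) :
    (star ψ₁ ⬝ᵥ ((totalSpinSq 1 : Op V 2) *ᵥ ψ₁)).re ≤
      (star ψ₂ ⬝ᵥ ((totalSpinSq 1 : Op V 2) *ᵥ ψ₂)).re := by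
  refine casimir_monotone_of_block 1 (⊤ : SimpleGraph V) (J := -1)
    (c := (3 / 4 : ℝ) * (Fintype.card V : ℝ)) (a := 2) (by norm_num) h12 h2
    {ψ : (V → Fin 2) → ℂ | star ψ ⬝ᵥ ψ = 1} ?_ g₁m g₁n g₁e g₂m g₂n g₂e g₁n g₂n
  intro ψ hψ
  have hn : star ψ ⬝ᵥ ψ = 1 := hψ
  rw [completeGraph_re_totalSpinSq, hn, Complex.one_re, mul_one]

/-- **`U_vt` on `K_n`, all sectors, `Δ₁ < Δ₂ ≤ 1`**: the condensate `Λ = Re⟨ψ, S⁺_tot S⁻_tot ψ⟩` of the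
normalised sector ground states of the complete-graph XXZ ferromagnet is non-decreasing in the
anisotropy (`Re⟨ψ,𝐒²ψ⟩ = Λ(ψ) + (M² − M)‖ψ‖²`). [folklore] -/
theorem completeGraph_condensate_monotone {M Δ₁ Δ₂ : ℝ} (h12 : Δ₁ < Δ₂) (h2 : Δ₂ ≤ 1)
    {ψ₁ ψ₂ : (V → Fin 2) → ℂ}
    (g₁m : ψ₁ ∈ spinZSector (Λ := V) 1 M) (g₁n : star ψ₁ ⬝ᵥ ψ₁ = 1)
    (g₁e : (xxzHamiltonian 1 (⊤ : SimpleGraph V) (-1) Δ₁ : Op V 2) *ᵥ ψ₁ =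
      ((lowestEnergyInSector 1 (xxzHamiltonian 1 (⊤ : SimpleGraph V) (-1) Δ₁) M : ℝ) : ℂ) • ψ₁)
    (g₂m : ψ₂ ∈ spinZSector (Λ := V) 1 M) (g₂n : star ψ₂ ⬝ᵥ ψ₂ = 1)
    (g₂e : (xxzHamiltonian 1 (⊤ : SimpleGraph V) (-1) Δ₂ : Op V 2) *ᵥ ψ₂ =
      ((lowestEnergyInSector 1 (xxzHamiltonian 1 (⊤ : SimpleGraph V) (-1) Δ₂) M : ℝ) : ℂ) • ψ₂) :
    (star ψ₁ ⬝ᵥ (((∑ x, onSite x (spinRaise 1)) * (∑ y, onSite y (spinLower 1)) : Op V 2) *ᵥ ψ₁)).re ≤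
      (star ψ₂ ⬝ᵥ (((∑ x, onSite x (spinRaise 1)) * (∑ y, onSite y (spinLower 1)) : Op V 2) *ᵥ ψ₂)).re := by
  have h := completeGraph_totalSpinSq_monotone h12 h2 g₁m g₁n g₁e g₂m g₂n g₂e
  rw [OneMagnon.re_totalSpinSq_eq_condensate_add g₁m, OneMagnon.re_totalSpinSq_eq_condensate_add g₂m,
    g₁n, g₂n] at h
  simpa using h

end Summit.HubbardSuperconductivity.HubbardSuperconductivity.Theorems.AnisotropyChord
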